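import Mathlib
import Summits.AtomisticToContinuum.Crystallization.Theorems.PricedLinkCensusTruncatedCensusGapBarlowWindowLink

/-!
# The first shell of a Barlow stacking on the near window `0.78a ≤ c ≤ 0.86a`

Helper file for the stub `stub_nearPricingEngine` (N3) of the line `near-far-split` of the crux
`PricedLinkCensus.TruncatedCensusGap` (item stmt-AtomisticToContinuum-14230), skeleton
`Cruxes/TruncatedCensusGap/Lines/near_far_split.lean`.

Wide-window twin of `PricedLinkCensusTruncatedCensusGapBarlowWindowLink` (`0.81a ≤ c ≤ 0.85a`,
radius `7a/5`): on the layer-spacing window of the near-Barlow predicate, `0.78a ≤ c ≤ 0.86a`,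
the points of `barlowStacking a c s` (`s` Hägg, `0 < a`) other than a given point `z₀` and
closer than `13a/10` to it are exactly the twelve first-shell points — six in its layer at distance
`a`, three in each adjacent layer at distance `√(a²/3 + c²) ∈ [0.970a, 1.036a]` — and every other
point of the stacking is at distance `≥ 13a/10` from `z₀`.  (At `c = 0.78a` the second
adjacent-layer shell sits at `√(4a²/3 + c²) ≈ 1.393a < 7a/5`, so the radius `7a/5` of the
narrow-window file does not separate the shells here; `13a/10` does, with margin.)

* `wideShell_iff_offsets` — the classification by the twelve offsets of `BarlowCoordination`;
* `dist_eq_or_of_wideShell`, `le_dist_of_not_wideShell` — the two shell distances / the gap;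
* `wideShellSet_eq_union`, `ncard_wideShellSet` — the shell as a set, of size twelve;
* `barlowWideWindowShell` — the registered one-line form over an arbitrary point `z₀` of the
  stacking.
-/

noncomputable section

namespace Summit.AtomisticToContinuum.Crystallization.Theorems.PricedLinkCensusTruncatedCensusGap

open scoped BigOperators
open Literature.MathematicalPhysics.StatisticalMechanics

section WideWindow

variable {a c : ℝ} {s : ℤ → ℤ}

/-- `((m - m)² : ℤ)` cast to `ℝ` is `0`. [folklore] -/
private theorem cast_sub_self_sq' (m : ℤ) : (((m - m) ^ 2 : ℤ) : ℝ) = 0 := by simp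

-- adapted from `near_iff_offsets` in `PricedLinkCensusTruncatedCensusGapBarlowWindowLink`
/-- **The points closer than `13a/10` are the twelve offsets** (window `0.78a ≤ c ≤ 0.86a`).
A point `barlowPos a c s k' i' j'` different from `barlowPos a c s k i j` is closer than `13a/10`
to it iff it is one of the six in-layer neighbours, one of three points of layer `k + 1`
(offsets `threeOffsets (−s k)`) or one of three points of layer `k − 1`
(offsets `threeOffsets (s (k−1))`). [cite: HalesDSP2012, §1.3] -/
theorem wideShell_iff_offsets (hs : IsHaggSeq s) (ha : 0 < a) (hc1 : 78 / 100 * a ≤ c)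
    (hc2 : c ≤ 86 / 100 * a) (k i j k' i' j' : ℤ) :
    (barlowPos a c s k' i' j' ≠ barlowPos a c s k i j ∧
        dist (barlowPos a c s k' i' j') (barlowPos a c s k i j) < 13 / 10 * a) ↔
      (k' = k ∧ (i - i', j - j') ∈ sixOffsets) ∨
      (k' = k + 1 ∧ (i - i', j - j') ∈ threeOffsets (-s k)) ∨
      (k' = k - 1 ∧ (i - i', j - j') ∈ threeOffsets (s (k - 1))) := by
  rw [dist_comm]
  have h12 := twelve_mul_dist_sq_window a c s k i j k' i' j'
  have hd0 : 0 ≤ dist (barlowPos a c s k i j) (barlowPos a c s k' i' j') := dist_nonneg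
  have ha2 : 0 < a ^ 2 := by positivity
  have hc0 : 0 ≤ 78 / 100 * a := by positivity
  have hcsq : (78 / 100 * a) ^ 2 ≤ c ^ 2 := pow_le_pow_left₀ hc0 hc1 2
  have hcsq2 : c ^ 2 ≤ (86 / 100 * a) ^ 2 := pow_le_pow_left₀ (hc0.trans hc1) hc2 2
  have hsp : -s k = 1 ∨ -s k = -1 := by rcases hs k with h1 | h1 <;> omega
  have hsm : s (k - 1) = 1 ∨ s (k - 1) = -1 := hs (k - 1)
  have h1310 : 0 ≤ 13 / 10 * a := by positivity
  constructor
  · rintro ⟨hne, hlt⟩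
    have hd2 := pow_lt_pow_left₀ hlt hd0 two_ne_zero
    have hF0 : (0 : ℝ) ≤
        ((3 * (2 * (i - i') + (j - j') + (haggLabel s k - haggLabel s k')) ^ 2 +
          (3 * (j - j') + (haggLabel s k - haggLabel s k')) ^ 2 : ℤ) : ℝ) := by positivity
    have haF := mul_nonneg ha2.le hF0
    -- at most one layer apart
    have hK3 : (k - k') ^ 2 < 2 ^ 2 := by
      have hK3' : (((k - k') ^ 2 : ℤ) : ℝ) < 3 := by
        by_contra hge
        push Not at hge
        have h1 : 3 * c ^ 2 ≤ (((k - k') ^ 2 : ℤ) : ℝ) * c ^ 2 :=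
          mul_le_mul_of_nonneg_right hge (sq_nonneg c)
        nlinarith
      have : (k - k') ^ 2 < (3 : ℤ) := by exact_mod_cast hK3'
      omega
    obtain ⟨hK1, hK1'⟩ := abs_lt_of_sq_lt_sq' hK3 (by norm_num)
    rcases (show k' = k + 1 ∨ k' = k ∨ k' = k - 1 by omega) with hk' | hk' | hk'
    · subst hk'
      rw [haggLabel_sub_haggLabel_succ] at h12 hF0
      refine Or.inr (Or.inl ⟨rfl, (mem_threeOffsets_iff hsp).2 ?_⟩)
      have e1 : (((k - (k + 1)) ^ 2 : ℤ) : ℝ) = 1 := by push_cast; ring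
      rw [e1] at h12
      rcases adjLayer_eq_four_or_sixteen_le (P := i - i') (Q := j - j') hsp with h4 | h16
      · exact h4
      · exfalso
        have h16' : (16 : ℝ) ≤ ((3 * (2 * (i - i') + (j - j') + -s k) ^ 2 +
            (3 * (j - j') + -s k) ^ 2 : ℤ) : ℝ) := by exact_mod_cast h16
        nlinarith
    · subst hk'
      rw [sub_self, cast_sub_self_sq'] at h12
      refine Or.inl ⟨rfl, mem_sixOffsets_iff.2 ?_⟩
      by_cases hPQ : (i - i', j - j') = (0, 0)
      · exfalso
        simp only [Prod.mk.injEq, sub_eq_zero] at hPQ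
        exact hne (by rw [hPQ.1, hPQ.2])
      · have hge := twelve_le_inLayer hPQ
        have hlt24 :
            ((3 * (2 * (i - i') + (j - j') + 0) ^ 2 + (3 * (j - j') + 0) ^ 2 : ℤ) : ℝ) < 24 := by
          nlinarith
        have hlt24' : 3 * (2 * (i - i') + (j - j') + 0) ^ 2 + (3 * (j - j') + 0) ^ 2 < 24 := by
          exact_mod_cast hlt24
        have hm : 3 * (2 * (i - i') + (j - j')) ^ 2 + (3 * (j - j')) ^ 2 =
            12 * ((i - i') ^ 2 + (i - i') * (j - j') + (j - j') ^ 2) := by ring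
        simp only [add_zero] at hlt24'
        rw [hm] at hge hlt24' ⊢
        omega
    · subst hk'
      rw [haggLabel_sub_haggLabel_pred] at h12 hF0
      refine Or.inr (Or.inr ⟨rfl, (mem_threeOffsets_iff hsm).2 ?_⟩)
      have e1 : (((k - (k - 1)) ^ 2 : ℤ) : ℝ) = 1 := by push_cast; ring
      rw [e1] at h12
      rcases adjLayer_eq_four_or_sixteen_le (P := i - i') (Q := j - j') hsm with h4 | h16
      · exact h4
      · exfalso
        have h16' : (16 : ℝ) ≤ ((3 * (2 * (i - i') + (j - j') + s (k - 1)) ^ 2 +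
            (3 * (j - j') + s (k - 1)) ^ 2 : ℤ) : ℝ) := by exact_mod_cast h16
        nlinarith
  · intro hN
    -- `d² = a²` or `d² = a²/3 + c²`, so `0 < d < 13a/10`
    have hsq := sq_dist_of_offsets (a := a) (c := c) hs hN
    have hd2 : dist (barlowPos a c s k i j) (barlowPos a c s k' i' j') ^ 2 < (13 / 10 * a) ^ 2 := by
      rcases hsq with h1 | h1 <;> rw [h1] <;> nlinarith
    have hpos : 0 < dist (barlowPos a c s k i j) (barlowPos a c s k' i' j') ^ 2 := by
      rcases hsq with h1 | h1 <;> rw [h1] <;> nlinarith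
    refine ⟨fun heq => ?_, lt_of_pow_lt_pow_left₀ 2 h1310 hd2⟩
    rw [heq, dist_self] at hpos
    norm_num at hpos

/-- **The two shell distances.** A point of the stacking other than `barlowPos a c s k i j` and
closer than `13a/10` to it is at distance exactly `a` (in layer) or `√(a²/3 + c²)` (adjacent
layers). [cite: HalesDSP2012, §1.3] -/
theorem dist_eq_or_of_wideShell (hs : IsHaggSeq s) (ha : 0 < a) (hc1 : 78 / 100 * a ≤ c)
    (hc2 : c ≤ 86 / 100 * a) {k i j k' i' j' : ℤ}
    (hne : barlowPos a c s k' i' j' ≠ barlowPos a c s k i j)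
    (hlt : dist (barlowPos a c s k' i' j') (barlowPos a c s k i j) < 13 / 10 * a) :
    dist (barlowPos a c s k' i' j') (barlowPos a c s k i j) = a ∨
      dist (barlowPos a c s k' i' j') (barlowPos a c s k i j) = Real.sqrt (a ^ 2 / 3 + c ^ 2) := by
  have hN := (wideShell_iff_offsets hs ha hc1 hc2 k i j k' i' j').1 ⟨hne, hlt⟩
  rw [dist_comm]
  rcases sq_dist_of_offsets (a := a) (c := c) hs hN with h1 | h1
  · exact Or.inl ((sq_eq_sq₀ dist_nonneg ha.le).1 h1)
  · right
    rw [← h1, Real.sqrt_sq dist_nonneg]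

/-- **The shell as a set** is the image of the twelve offsets (window twin of
`BarlowCoordination.touching_eq_union`). [cite: HalesDSP2012, §1.3] -/
theorem wideShellSet_eq_union (hs : IsHaggSeq s) (ha : 0 < a) (hc1 : 78 / 100 * a ≤ c)
    (hc2 : c ≤ 86 / 100 * a) (k i j : ℤ) :
    {z | z ∈ barlowStacking a c s ∧ (z ≠ barlowPos a c s k i j ∧
        dist z (barlowPos a c s k i j) < 13 / 10 * a)} =
      offsetPos a c s i j k '' ↑sixOffsets ∪
        (offsetPos a c s i j (k + 1) '' ↑(threeOffsets (-s k)) ∪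
          offsetPos a c s i j (k - 1) '' ↑(threeOffsets (s (k - 1)))) := by
  ext w
  simp only [Set.mem_setOf_eq, Set.mem_union, Set.mem_image, Finset.mem_coe]
  constructor
  · rintro ⟨⟨k', i', j', rfl⟩, hd⟩
    rcases (wideShell_iff_offsets hs ha hc1 hc2 k i j k' i' j').1 hd with
      ⟨rfl, hm⟩ | ⟨rfl, hm⟩ | ⟨rfl, hm⟩
    · exact Or.inl ⟨(i - i', j - j'), hm, by simp [offsetPos]⟩
    · exact Or.inr (Or.inl ⟨(i - i', j - j'), hm, by simp [offsetPos]⟩)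
    · exact Or.inr (Or.inr ⟨(i - i', j - j'), hm, by simp [offsetPos]⟩)
  · rintro (⟨PQ, hm, rfl⟩ | ⟨PQ, hm, rfl⟩ | ⟨PQ, hm, rfl⟩) <;>
      refine ⟨barlowPos_mem _ _ _, (wideShell_iff_offsets hs ha hc1 hc2 k i j _ _ _).2 ?_⟩
    · exact Or.inl ⟨rfl, by simpa using hm⟩
    · exact Or.inr (Or.inl ⟨rfl, by simpa using hm⟩)
    · exact Or.inr (Or.inr ⟨rfl, by simpa using hm⟩)

/-- **Twelve shell points** (window twin of `BarlowCoordination.ncard_touching_barlowPos`).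
[cite: HalesDSP2012, §1.3] -/
theorem ncard_wideShellSet (hs : IsHaggSeq s) (ha : 0 < a) (hc1 : 78 / 100 * a ≤ c)
    (hc2 : c ≤ 86 / 100 * a) (k i j : ℤ) :
    {z | z ∈ barlowStacking a c s ∧ (z ≠ barlowPos a c s k i j ∧
        dist z (barlowPos a c s k i j) < 13 / 10 * a)}.ncard = 12 := by
  have hh0 : c ≠ 0 := by
    intro h0
    rw [h0] at hc1
    linarith
  rw [wideShellSet_eq_union hs ha hc1 hc2]
  have hinj := fun k' => offsetPos_injective (h := c) (s := s) ha i j k'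
  have hlay : ∀ {k₁ k₂ : ℤ} (A B : Finset (ℤ × ℤ)), k₁ ≠ k₂ →
      Disjoint (offsetPos a c s i j k₁ '' ↑A) (offsetPos a c s i j k₂ '' ↑B) := by
    intro k₁ k₂ A B hk
    refine Set.disjoint_left.2 ?_
    rintro _ ⟨PQ, _, rfl⟩ ⟨PQ', _, heq⟩
    exact hk (offsetPos_layer_eq hh0 heq.symm)
  have hfin : ∀ (k' : ℤ) (A : Finset (ℤ × ℤ)), (offsetPos a c s i j k' '' ↑A).Finite :=
    fun k' A => A.finite_toSet.image _
  rw [Set.ncard_union_eq ((hlay _ _ (by omega)).union_right (hlay _ _ (by omega))) (hfin _ _)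
      ((hfin _ _).union (hfin _ _)),
    Set.ncard_union_eq (hlay _ _ (by omega)) (hfin _ _) (hfin _ _),
    Set.ncard_image_of_injective _ (hinj _), Set.ncard_image_of_injective _ (hinj _),
    Set.ncard_image_of_injective _ (hinj _), Set.ncard_coe_finset, Set.ncard_coe_finset,
    Set.ncard_coe_finset, card_sixOffsets, card_threeOffsets, card_threeOffsets]

/-- **The gap behind the first shell**: a point of the stacking that is neither `z₀` nor at one of
the two shell distances from `z₀` is at distance `≥ 13a/10` from it. [folklore] -/
theorem le_dist_of_not_wideShell (hs : IsHaggSeq s) (ha : 0 < a) (hc1 : 78 / 100 * a ≤ c)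
    (hc2 : c ≤ 86 / 100 * a) {z₀ z : EuclideanSpace ℝ (Fin 3)}
    (hz₀ : z₀ ∈ barlowStacking a c s) (hz : z ∈ barlowStacking a c s) (hne : z ≠ z₀)
    (hna : dist z z₀ ≠ a) (hnc : dist z z₀ ≠ Real.sqrt (a ^ 2 / 3 + c ^ 2)) :
    13 / 10 * a ≤ dist z z₀ := by
  obtain ⟨k, i, j, rfl⟩ := hz₀
  obtain ⟨k', i', j', rfl⟩ := hz
  by_contra hlt
  rw [not_le] at hlt
  rcases dist_eq_or_of_wideShell hs ha hc1 hc2 hne hlt with h | h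
  · exact hna h
  · exact hnc h

/-- **Bounds on the adjacent-layer shell distance** on the window: `a/2 < √(a²/3 + c²) ≤ 53a/50`
(indeed `∈ [0.970a, 1.036a]`). [folklore] -/
theorem sqrt_shell_bounds (ha : 0 < a) (hc1 : 78 / 100 * a ≤ c) (hc2 : c ≤ 86 / 100 * a) :
    a / 2 < Real.sqrt (a ^ 2 / 3 + c ^ 2) ∧ Real.sqrt (a ^ 2 / 3 + c ^ 2) ≤ 53 / 50 * a := by
  have hc0 : 0 ≤ c := le_trans (by positivity) hc1
  constructor
  · rw [Real.lt_sqrt (by positivity)]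
    nlinarith
  · rw [Real.sqrt_le_left (by positivity)]
    nlinarith

/-- **The first shell by distances** equals the shell by radius: on the window, the points of the
stacking at distance `a` or `√(a²/3 + c²)` from `z₀` are exactly the points other than `z₀`
closer than `13a/10`. [folklore] -/
theorem wideShellSet_eq_distSet (hs : IsHaggSeq s) (ha : 0 < a) (hc1 : 78 / 100 * a ≤ c)
    (hc2 : c ≤ 86 / 100 * a) {z₀ : EuclideanSpace ℝ (Fin 3)} (hz₀ : z₀ ∈ barlowStacking a c s) :
    {z | z ∈ barlowStacking a c s ∧ (z ≠ z₀ ∧ dist z z₀ < 13 / 10 * a)} =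
      {z | z ∈ barlowStacking a c s ∧
        (dist z z₀ = a ∨ dist z z₀ = Real.sqrt (a ^ 2 / 3 + c ^ 2))} := by
  obtain ⟨hlo, hhi⟩ := sqrt_shell_bounds ha hc1 hc2
  ext z
  simp only [Set.mem_setOf_eq]
  refine and_congr_right fun hz => ⟨fun ⟨hne, hlt⟩ => ?_, fun h => ⟨fun heq => ?_, ?_⟩⟩
  · obtain ⟨k, i, j, rfl⟩ := hz₀
    obtain ⟨k', i', j', rfl⟩ := hz
    exact dist_eq_or_of_wideShell hs ha hc1 hc2 hne hlt
  · rw [heq, dist_self] at h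
    rcases h with h | h <;> linarith
  · rcases h with h | h <;> rw [h] <;> linarith

end WideWindow

/-- **Barlow first shell on the near window (registered form).** For `0 < a`, `0.78a ≤ c ≤ 0.86a` and a Hägg sequence `s`, about every point `z₀` of `barlowStacking a c s`: every other point of the stacking closer than `13a/10` is at distance exactly `a` or `√(a²/3 + c²)` from `z₀`, and the points at these two distances number exactly twelve. [cite: HalesDSP2012, §1.3] -/
theorem barlowWideWindowShell : ∀ (a c : ℝ) (s : ℤ → ℤ), 0 < a → 78 / 100 * a ≤ c → c ≤ 86 / 100 * a → Literature.MathematicalPhysics.StatisticalMechanics.IsHaggSeq s → ∀ z₀ ∈ Literature.MathematicalPhysics.StatisticalMechanics.barlowStacking a c s, (∀ z ∈ Literature.MathematicalPhysics.StatisticalMechanics.barlowStacking a c s, z ≠ z₀ → dist z z₀ < 13 / 10 * a → dist z z₀ = a ∨ dist z z₀ = Real.sqrt (a ^ 2 / 3 + c ^ 2)) ∧ {z | z ∈ Literature.MathematicalPhysics.StatisticalMechanics.barlowStacking a c s ∧ (dist z z₀ = a ∨ dist z z₀ = Real.sqrt (a ^ 2 / 3 + c ^ 2))}.ncard = 12 :=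 by
  intro a c s ha hc1 hc2 hs z₀ hz₀
  refine ⟨fun z hz hne hlt => ?_, ?_⟩
  · obtain ⟨k, i, j, rfl⟩ := hz₀
    obtain ⟨k', i', j', rfl⟩ := hz
    exact dist_eq_or_of_wideShell hs ha hc1 hc2 hne hlt
  · rw [← wideShellSet_eq_distSet hs ha hc1 hc2 hz₀]
    obtain ⟨k, i, j, rfl⟩ := hz₀
    exact ncard_wideShellSet hs ha hc1 hc2 k i j

end Summit.AtomisticToContinuum.Crystallization.Theorems.PricedLinkCensusTruncatedCensusGap

end
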